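import Mathlib
import Literature.AlgebraicGeometry.Resolution.LogRegularAtlasGluing
import Literature.AlgebraicGeometry.Resolution.BoundarySpread
import Literature.AlgebraicGeometry.Resolution.KummerChartFromSections
import Summits.ResolutionOfSingularities.ResolutionOfSingularities.Theorems.PAlterationPicoverLocalModelLocalChartsDispatch
import Summits.ResolutionOfSingularities.ResolutionOfSingularities.Theorems.PAlterationPicoverLocalModelLocalChartsPointData
import Summits.ResolutionOfSingularities.ResolutionOfSingularities.Theorems.PAlterationPicoverLocalModelLocalChartsKummerCentre

/-!
# Crux `PicoverLocalModel` (stmt-ResolutionOfSingularities-0557), line `SketchIdeator3`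
# (giraud-cossart-normal-form) — endgame, local charts: the chart at a point over a
# wound/transversal centre

Helper of the stub `stub_localCharts`: assembly of the local log-regular chart of the
normalised cover `(normalization Y, ν ≫ q)` at a point `y` whose image `w ∈ W` is a
wound/transversal centre of the Giraud normal form (`a = g^p + (∏ x_j^{B_j})^p u`, `u` wound or
a transversal parameter), for a finite surjective `q : Y → W` whose sections over affine opens
of `W` are generated by a `p`-th root of `π^* a`: spread the data to an affine `U ∋ w`
(`exists_affineOpen_spread`), take `V = (ν ≫ q)⁻¹ U` and the orthant chart
`ℕ^r → Γ(Y^ν, V)`, `v ↦ ∏ x_j^{v_j}`, and verify Kato's condition at every prime and the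
prescribed stalk monoids at every point of `V` by `localChart_pointwise_orthant`.
-/

noncomputable section

-- single-problem summit: the doubled namespace component `ResolutionOfSingularities` is the tree layout
set_option linter.dupNamespace false

open CategoryTheory CategoryTheory.Limits AlgebraicGeometry TopologicalSpace Polynomial IsLocalRing
open Literature.AlgebraicGeometry.Resolution

namespace Summit.ResolutionOfSingularities.ResolutionOfSingularities.Theorems.PicoverLocalModel.LocalCharts

/-- **The local chart at a point over a wound/transversal centre.** See the module docstring.
[cite: Kato1994, Def. (2.1) and Thm. 11.6] -/
theorem localChart_woundCentre : ∀ (p : ℕ) [Fact p.Prime] (k : Type) [Field k] [CharP k p] (W : Scheme.{0}) (f : W ⟶ Spec (.of k)) [LocallyOfFiniteType f] [IsIntegral W], Scheme.IsRegular W → ∀ (R : Type) [CommRing R] (π : W ⟶ Spec (.of R)) (a : R) (E : List W.IdealSheafData), HasSNC E → InGiraudNormalForm p W π a E → ∀ (Y : Scheme.{0}) [IsIntegral Y] (q : Y ⟶ W) [IsFinite q] [Surjective q], (∀ U : W.affineOpens, ∃ tY : Γ(Y, q ⁻¹ᵁ (U : W.Opens)), tY ^ p = q.app U (π.appLE ⊤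 U le_top ((Scheme.ΓSpecIso (.of R)).inv a)) ∧ ∀ b : Γ(Y, q ⁻¹ᵁ (U : W.Opens)), ∃ P : Γ(W, U)[X], b = P.eval₂ (q.app U).hom tY) → ∀ (y : ↥(normalization Y)) (w : W) (hw : (normalizationι Y ≫ q).base y = w) {r : ℕ} (D : Fin r → {D : W.IdealSheafData // D ∈ E ∧ w ∈ D.support}) (x : Fin r → W.presheaf.stalk w), Function.Bijective D → (∀ j, stalkIdeal (D j).1 w = Ideal.span {x j}) → ∀ (g₀ u₀ : W.presheaf.stalk w) (Bexp : Fin r → ℕ), IsWoundOrTransversalAt p x u₀ → (W.presheaf.germ ⊤ w trivial) (π.appTop ((Scheme.ΓSpecIso (.of R)).inv a)) = g₀ ^ p + (∏ j, x j ^ Bexp j) ^ p * u₀ → Nonempty (LocalLogRegularChart (normalization Y) (fun y => divisorialMonoid (((E.map fun D => stalkIdeal D ((normalizationι Y ≫ q).base y))).prod.map ((normalizationι Y ≫ q).stalkMap y).hom)) y) := by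
  intro p _ k _ _ W f _ _ hreg R _ π a E hE hG Y _ q _ _ hsec y w hw r D x hDbij hDgen g₀ u₀ Bexp hwt₀ ha₀
  classical
  have hp : p.Prime := Fact.out
  haveI : IsLocallyNoetherian W := LocallyOfFiniteType.isLocallyNoetherian f
  set gq := normalizationι Y ≫ q with hgq
  -- the centre
  haveI hregw : IsRegularLocalRing (W.presheaf.stalk w) := hreg w
  haveI := isDomain_of_isRegularLocalRing (W.presheaf.stalk w)
  obtain ⟨hxm, hli⟩ := hli_of_hasSNC hE w D hDbij.1 x hDgen
  have hxprime : ∀ j, (Ideal.span {x j}).IsPrime := RegularParameters.isPrime_span_singleton hxm hli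
  have hx0 : ∀ j, x j ≠ 0 := fun j h0 => RegularParameters.notMem_sq hli j (h0 ▸ Ideal.zero_mem _)
  -- spread to an affine open `U ∋ w`
  obtain ⟨U, hwU, xs, fs, us, hxs, hfs, hus, husu, hB1, hB2, hprime⟩ :=
    exists_affineOpen_spread E w D (fun D' hD' hsupp => hDbij.2 ⟨D', hD', hsupp⟩ |>.imp fun j hj =>
      congrArg Subtype.val hj) x hDgen hxprime ![g₀, u₀] ![] (fun k => k.elim0)
  set gs := fs 0 with hgs
  set uw := fs 1 with huw
  set aU : Γ(W, (U : W.Opens)) := π.appLE ⊤ U le_top ((Scheme.ΓSpecIso (.of R)).inv a) with haU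
  have hgerm_aU : W.presheaf.germ (U : W.Opens) w hwU aU =
      W.presheaf.germ ⊤ w trivial (π.appTop ((Scheme.ΓSpecIso (.of R)).inv a)) := by
    rw [haU, Scheme.Hom.appLE, CommRingCat.comp_apply]
    exact TopCat.Presheaf.germ_res_apply W.presheaf (homOfLE le_top) w hwU _
  -- the identity in `A = Γ(W, U)`
  have hA : aU = gs ^ p + (∏ j, xs j ^ Bexp j) ^ p * uw := by
    apply germ_injective_of_isIntegral (X := W) w hwU
    rw [hgerm_aU, ha₀, map_add, map_pow, map_mul, map_pow, map_prod]
    simp only [map_pow, hxs, hgs, huw, hfs]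
    rfl
  have hxs0' : ∀ j, xs j ≠ 0 := by
    intro j h0; apply hx0 j; rw [← hxs j, h0, map_zero]
  -- sections of the normalised cover over `U`
  obtain ⟨tY, htYp, hgen⟩ := hsec U
  have hyV : y ∈ gq ⁻¹ᵁ (U : W.Opens) := by
    change gq.base y ∈ (U : W.Opens); rw [hgq, hw]; exact hwU
  obtain ⟨hVaff, hic, hint, hinj, t, ht, hbir⟩ :=
    sections_normalization_of_generated q U hp.ne_zero aU tY htYp hgen ⟨⟨y, hyV⟩⟩
  haveI : Nonempty (gq ⁻¹ᵁ (U : W.Opens)) := ⟨⟨y, hyV⟩⟩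
  haveI : Nonempty (U : W.Opens) := ⟨⟨w, hwU⟩⟩
  letI algAB : Algebra Γ(W, (U : W.Opens)) Γ(normalization Y, gq ⁻¹ᵁ (U : W.Opens)) :=
    (gq.app U).hom.toAlgebra
  have halg : ∀ s, algebraMap Γ(W, (U : W.Opens)) Γ(normalization Y, gq ⁻¹ᵁ (U : W.Opens)) s =
      gq.app U s := fun s => rfl
  haveI : Algebra.IsIntegral Γ(W, (U : W.Opens)) Γ(normalization Y, gq ⁻¹ᵁ (U : W.Opens)) :=
    ⟨fun z => hint z⟩
  haveI : IsIntegrallyClosed Γ(normalization Y, gq ⁻¹ᵁ (U : W.Opens)) := hic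
  have hinj' : Function.Injective (algebraMap Γ(W, (U : W.Opens)) Γ(normalization Y, gq ⁻¹ᵁ (U : W.Opens))) :=
    hinj
  haveI : CharP Γ(W, (U : W.Opens)) p :=
    charP_of_injective_ringHom ((Scheme.ΓSpecIso (.of k)).inv ≫ f.appLE ⊤ U le_top).hom.injective p
  haveI : CharP Γ(normalization Y, gq ⁻¹ᵁ (U : W.Opens)) p := charP_of_injective_ringHom hinj' p
  have ht' : t ^ p = algebraMap _ _ aU := ht
  have hbir' : ∀ z : Γ(normalization Y, gq ⁻¹ᵁ (U : W.Opens)), ∃ d : Γ(W, (U : W.Opens)), d ≠ 0 ∧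
      ∃ P : Γ(W, (U : W.Opens))[X], algebraMap _ _ d * z = aeval t P := by
    intro z; obtain ⟨d, hd, P, hP⟩ := hbir z; refine ⟨d, hd, P, ?_⟩; rw [aeval_def]; exact hP
  -- the orthant chart
  let Φ : Multiplicative (AddSubmonoid.nonneg (Fin r → ℤ)) →* Γ(normalization Y, gq ⁻¹ᵁ (U : W.Opens)) :=
    { toFun := fun v => algebraMap Γ(W, (U : W.Opens)) _
        (∏ j, xs j ^ (((Multiplicative.toAdd v).1) j).toNat)
      map_one' := by simp
      map_mul' := fun v v' => by
        rw [← map_mul, ← Finset.prod_mul_distrib]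
        congr 1
        refine Finset.prod_congr rfl fun j _ => ?_
        rw [← pow_add, ← Int.toNat_add ((Multiplicative.toAdd v).2 j) ((Multiplicative.toAdd v').2 j)]
        rfl }
  have hΦ : ∀ v : AddSubmonoid.nonneg (Fin r → ℤ), Φ (Multiplicative.ofAdd v) =
      algebraMap Γ(W, (U : W.Opens)) _ (∏ j, xs j ^ ((v : Fin r → ℤ) j).toNat) := fun v => rfl
  -- data along `E`
  have hDE : ∀ j, (D j).1 ∈ E := fun j => (D j).2.1
  have hDinj : Function.Injective (fun j => (D j).1) := fun i j h => hDbij.1 (Subtype.ext h)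
  -- the centre as a localization of `A`
  letI := W.presheaf.algebra_section_stalk (⟨w, hwU⟩ : (U : W.Opens))
  haveI := U.2.isLocalization_stalk ⟨w, hwU⟩
  have hmem𝔮 : ∀ (w' : W) (hw' : w' ∈ (U : W.Opens)) (s : Γ(W, (U : W.Opens))),
      s ∈ (U.2.primeIdealOf ⟨w', hw'⟩).asIdeal ↔ ¬ IsUnit (W.presheaf.germ (U : W.Opens) w' hw' s) := by
    intro w' hw' s
    letI := W.presheaf.algebra_section_stalk (⟨w', hw'⟩ : (U : W.Opens))
    haveI := U.2.isLocalization_stalk ⟨w', hw'⟩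
    rw [← IsLocalization.AtPrime.to_map_mem_maximal_iff (W.presheaf.stalk w') (U.2.primeIdealOf ⟨w', hw'⟩).asIdeal s,
      IsLocalRing.mem_maximalIdeal, mem_nonunits_iff]
    rfl
  obtain ⟨hxm', hli₀⟩ := hli_of_hasSNC hE w D hDbij.1 (fun j => W.presheaf.germ (U : W.Opens) w hwU (xs j))
    fun j => stalkIdeal_eq_span_germ_of_spread (D := fun j => (D j).1) hB1 hwU j
  have hx₀ : ∀ j, xs j ∈ (U.2.primeIdealOf ⟨w, hwU⟩).asIdeal := fun j =>
    (hmem𝔮 w hwU _).mpr fun hu => (IsLocalRing.mem_maximalIdeal _).mp (hxm' j) hu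
  have hwt₀' : IsWoundOrTransversalAt p (fun j => algebraMap Γ(W, (U : W.Opens)) (W.presheaf.stalk w) (xs j))
      (algebraMap Γ(W, (U : W.Opens)) (W.presheaf.stalk w) uw) := by
    have h1 : (fun j => algebraMap Γ(W, (U : W.Opens)) (W.presheaf.stalk w) (xs j)) = x :=
      funext fun j => hxs j
    have h2 : algebraMap Γ(W, (U : W.Opens)) (W.presheaf.stalk w) uw = u₀ := by
      rw [huw]; exact hfs 1
    rw [h1, h2]; exact hwt₀
  -- Kato's condition and the stalk monoid at every point of `V`, via the local model
  have perPoint : ∀ (y' : ↥(normalization Y)) (hy' : y' ∈ gq ⁻¹ᵁ (U : W.Opens)) (N : Type) [CommRing N]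
      [Algebra Γ(normalization Y, gq ⁻¹ᵁ (U : W.Opens)) N]
      [IsLocalization.AtPrime N (hVaff.primeIdealOf ⟨y', hy'⟩).asIdeal],
      LogChart.IsLogRegularLocal (AddSubmonoid.nonneg (Fin r → ℤ))
        ((algebraMap Γ(normalization Y, gq ⁻¹ᵁ (U : W.Opens)) N).toMonoidHom.comp Φ) ∧
      ∀ σN : W.presheaf.stalk (gq.base y') →+* N,
        σN.comp (W.presheaf.germ (U : W.Opens) (gq.base y') hy').hom =
          (algebraMap Γ(normalization Y, gq ⁻¹ᵁ (U : W.Opens)) N).comp (algebraMap Γ(W, (U : W.Opens)) _) →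
        divisorialMonoid (Ideal.span {σN (W.presheaf.germ (U : W.Opens) (gq.base y') hy' (∏ j, xs j))}) =
          IsUnit.submonoid N ⊔ MonoidHom.mrange ((algebraMap Γ(normalization Y, gq ⁻¹ᵁ (U : W.Opens)) N).toMonoidHom.comp Φ) := by
    intro y' hy' N _ _ _
    have hw'U : gq.base y' ∈ (U : W.Opens) := hy'
    letI := W.presheaf.algebra_section_stalk (⟨gq.base y', hw'U⟩ : (U : W.Opens))
    haveI := U.2.isLocalization_stalk ⟨gq.base y', hw'U⟩
    haveI : IsRegularLocalRing (W.presheaf.stalk (gq.base y')) := hreg _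
    have hcomap : ((hVaff.primeIdealOf ⟨y', hy'⟩).asIdeal).comap
        (algebraMap Γ(W, (U : W.Opens)) Γ(normalization Y, gq ⁻¹ᵁ (U : W.Opens))) =
        (U.2.primeIdealOf ⟨gq.base y', hw'U⟩).asIdeal := by
      ext s
      rw [Ideal.mem_comap, halg, ← Scheme.Hom.appLE_eq_app]
      exact mem_primeIdealOf_iff_of_stalkMap gq U.2 hVaff le_rfl y' hy' s
    haveI : IsLocalization.AtPrime (W.presheaf.stalk (gq.base y'))
        (((hVaff.primeIdealOf ⟨y', hy'⟩).asIdeal).comap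
          (algebraMap Γ(W, (U : W.Opens)) Γ(normalization Y, gq ⁻¹ᵁ (U : W.Opens)))) :=
      isLocalization_atPrime_of_eq _ _ hcomap
    have hmem' : ∀ s : Γ(W, (U : W.Opens)), s ∈ ((hVaff.primeIdealOf ⟨y', hy'⟩).asIdeal).comap
        (algebraMap Γ(W, (U : W.Opens)) Γ(normalization Y, gq ⁻¹ᵁ (U : W.Opens))) ↔
        ¬ IsUnit (W.presheaf.germ (U : W.Opens) (gq.base y') hw'U s) := fun s => by
      rw [hcomap]; exact hmem𝔮 _ hw'U s
    have key := localChart_pointwise_orthant (O₀ := W.presheaf.stalk w) (O := W.presheaf.stalk (gq.base y'))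
      (N := N) p xs aU gs uw Bexp hA hwt₀' hprime hinj' t ht' hbir' Φ hΦ
      (U.2.primeIdealOf ⟨w, hwU⟩).asIdeal hx₀ hli₀ (hVaff.primeIdealOf ⟨y', hy'⟩).asIdeal
      (fun s σ hσ hmem => (hli_of_spread (D := fun j => (D j).1) hDE hDinj hB1 hw'U hE σ hσ
        fun i => (hmem' (xs (σ i))).mp (hmem i)).2)
      (fun s σ hσ hJ => pointData_giraudNormalFormAt hDE hDinj hB1 hB2 hw'U π a hG σ hσ
        fun j => (hmem' (xs j)).symm.trans (hJ j))
    exact ⟨key.1, fun σN hσN => key.2 σN hσN⟩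
  -- the chart record
  refine ⟨⟨⟨gq ⁻¹ᵁ (U : W.Opens), hVaff⟩, hyV, r, AddSubmonoid.nonneg (Fin r → ℤ), Φ,
    nonneg_fg, nonneg_saturated, span_nonneg_eq_top, fun 𝔓 _ => ?_, fun y' hy' => ?_⟩⟩
  · -- Kato's condition at `𝔓`
    obtain ⟨⟨y', hy'⟩, hy'𝔓⟩ := exists_point_of_prime hVaff 𝔓
    have h𝔓 : (hVaff.primeIdealOf ⟨y', hy'⟩).asIdeal = 𝔓 := by rw [hy'𝔓]
    haveI : IsLocalization.AtPrime (Localization.AtPrime 𝔓) (hVaff.primeIdealOf ⟨y', hy'⟩).asIdeal :=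
      isLocalization_atPrime_of_eq _ _ h𝔓
    rw [LogChart.isLogRegularAt_iff_isLogRegularLocal]
    exact (perPoint y' hy' (Localization.AtPrime 𝔓)).1
  · -- the stalk monoid at `y'`
    letI := (normalization Y).presheaf.algebra_section_stalk (⟨y', hy'⟩ : gq ⁻¹ᵁ (U : W.Opens))
    haveI := hVaff.isLocalization_stalk ⟨y', hy'⟩
    have hσN : (gq.stalkMap y').hom.comp (W.presheaf.germ (U : W.Opens) (gq.base y') hy').hom =
        (algebraMap Γ(normalization Y, gq ⁻¹ᵁ (U : W.Opens)) ((normalization Y).presheaf.stalk y')).comp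
          (algebraMap Γ(W, (U : W.Opens)) _) := by
      have := Scheme.Hom.germ_stalkMap gq (U : W.Opens) y' hy'
      rw [← CommRingCat.hom_comp, this, CommRingCat.hom_comp]
      rfl
    have key := (perPoint y' hy' ((normalization Y).presheaf.stalk y')).2 (gq.stalkMap y').hom hσN
    change chartStalkMonoid _ Φ y' hy' =
      divisorialMonoid (((E.map fun D => stalkIdeal D (gq.base y')).prod).map (gq.stalkMap y').hom)
    rw [pointData_divisorialMonoid (D := fun j => (D j).1) hDE hB1 hB2 hy' (gq.stalkMap y').hom, key,
      chartStalkMonoid, MonoidHom.map_mrange]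
    rfl

end Summit.ResolutionOfSingularities.ResolutionOfSingularities.Theorems.PicoverLocalModel.LocalCharts

end
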